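import Literature.Probability.Percolation.CoveringQuotientMap
import Literature.Probability.Percolation.EnhancedClusterModification
import HarnessLib

/-!
# Two disjoint lifts around a wrapped ball: the witness of Martineau–Severo's Lemma 5.1 for the
# quotient map of a free action

Support file of the inline proof of `Literature.Probability.Percolation.MartineauSevero2019_cor22`.
Martineau–Severo (Ann. Probab. 47 (2019), §5):

> **Lemma 5.1.** There is a choice of `r ≥ 1` such that for every `x ∈ V(𝒢)`, the set `Z = Z(x,r)`
> defined as the connected component of `x` in `π⁻¹(B_r(π(x))) ∩ B_{3r}(x)` satisfies that for any
> `u ∈ S_{r+1}(π(x))`, the fibre `π⁻¹({u})` contains at least two vertices adjacent to `Z`.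

and, in the coupling ("Substep (2K+2)"), what is used of it: for every vertex `v` of the sphere
`S_{r+1}(π x)` there is an `ℋ`-edge `e = {w, v}` of `S_{r+½}(π x)` having TWO DISTINCT lifts adjacent
to `Z` — of which at most one can be the designated (already `p`-explored) lift, so that a fresh one is
available. The printed proof obtains the two lifts from the disjoint tree-lifting property
(Lemma 7.1: translate a lifted tree by the group element `g` with `g x = y`). For the quotient map of a
FREE action we build the witness directly, with the same translation idea and no trees: with `g = g_x`
moving `x` inside `B_R(x)`, `R ≤ 2r` (tame fibres, Lemma 7.2, taken here as the hypothesis `hR`), lift a geodesic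
`π x = u₀ ∼ ⋯ ∼ u_r ∼ v` to a walk `P` from `x` to `z₁` over `u_r` and one more edge `ê₁ = {z₁, v₁}` over
`{u_r, v}`; then `ê₂ := g • ê₁ = {g z₁, g v₁}` is a second lift of the same `ℋ`-edge, distinct from
`ê₁` by freeness, and `z₁`, `g z₁` are joined to `x` by the walks `P` and `γ_x · (g • P)` (`γ_x` a walk from
`x` to `g x` of length `≤ 2r`), all of whose vertices lie in `B_{3r}(x)` and project into `B_r(π x)`.

* `exists_twoLiftWitness` — for every `x`: a finite set `Wt` of edges of `𝒢` (the witness edges: those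
  of `γ_x`, `P_v`, `g • P_v`), all with endpoints in `B_{3r}(x) ∩ π⁻¹(B_r(π x))`, of cardinality
  `≤ 4 r (1 + |B_{r+1}(π x)|)`, such that every `v` with `d(π x, v) = r + 1` admits `w` with
  `d(π x, w) = r`, `w ∼ v`, and two distinct lifts `s(z₁, v₁) ≠ s(z₂, v₂)` of `{w, v}` whose feet
  `z₁, z₂` are reachable from `x` using witness edges only.

## References

* S. Martineau, F. Severo, Ann. Probab. 47 (2019), §5 Lemma 5.1 and Substep of Step `2K+2` ("there
  is at least one lift `e'` of `e` that is adjacent to `Z(x,r)` and `p`-unexplored"), §7 Lemma 7.1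
  [MartineauSevero2019].
-/

namespace Literature.Probability.Percolation

open Literature.Barriers.CriticalPhenomena

variable {V : Type*}

/-! ### Walk bookkeeping -/

section Walks

variable {G : SimpleGraph V}

/-- A support vertex splits the walk. [folklore] -/
theorem exists_split_of_mem_support {x y z : V} (w : G.Walk x y) (hz : z ∈ w.support) :
    ∃ (q : G.Walk x z) (q' : G.Walk z y), q.length + q'.length = w.length := by
  obtain ⟨q, q', rfl⟩ := SimpleGraph.Walk.mem_support_iff_exists_append.1 hz
  exact ⟨q, q', (SimpleGraph.Walk.length_append q q').symm⟩

/-- Support vertices lie in the ball of radius the length around the start. [folklore] -/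
theorem support_subset_graphBall_start {x y z : V} (w : G.Walk x y) (hz : z ∈ w.support) :
    z ∈ graphBall G x w.length := by
  obtain ⟨q, q', h⟩ := exists_split_of_mem_support w hz
  exact ⟨q, by omega⟩

/-- Support vertices lie in the ball of radius the length around the end. [folklore] -/
theorem support_subset_graphBall_end {x y z : V} (w : G.Walk x y) (hz : z ∈ w.support) :
    z ∈ graphBall G y w.length := by
  obtain ⟨q, q', h⟩ := exists_split_of_mem_support w hz
  exact ⟨q'.reverse, by rw [SimpleGraph.Walk.length_reverse]; omega⟩

/-- **Reachability through the walk's own edges**: every support vertex of `w` is reachable from the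
start in the graph spanned by any edge set containing the edges of `w`. [folklore] -/
theorem reachable_fromEdgeSet_of_mem_support {x y : V} (w : G.Walk x y) {F : Set (Sym2 V)}
    (hF : ∀ e ∈ w.edges, e ∈ F) {z : V} (hz : z ∈ w.support) :
    (SimpleGraph.fromEdgeSet F).Reachable x z := by
  obtain ⟨q, q', rfl⟩ := SimpleGraph.Walk.mem_support_iff_exists_append.1 hz
  have hq : ∀ e ∈ q.edges, e ∈ (SimpleGraph.fromEdgeSet F).edgeSet := by
    intro e he
    rw [SimpleGraph.edgeSet_fromEdgeSet]
    refine ⟨hF e (by rw [SimpleGraph.Walk.edges_append]; exact List.mem_append_left _ he), ?_⟩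
    exact SimpleGraph.not_isDiag_of_mem_edgeSet _ (q.edges_subset_edgeSet he)
  exact ⟨q.transfer _ hq⟩

variable {Γ : Type*} [Group Γ] [MulAction Γ V]

/-- The support of a translated walk. [folklore] -/
theorem mem_support_map_smulIso_iff (hact : IsActionByAut G Γ) (g : Γ) {x y z : V} (w : G.Walk x y) :
    z ∈ (w.map (smulIso hact g).toHom).support ↔ g⁻¹ • z ∈ w.support := by
  rw [SimpleGraph.Walk.support_map, List.mem_map]
  constructor
  · rintro ⟨a, ha, rfl⟩
    simpa using ha
  · intro h
    exact ⟨g⁻¹ • z, h, by simp⟩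

end Walks

/-! ### The two lifts -/

section TwoLifts

variable {Γ : Type*} [Group Γ] [MulAction Γ V]

/-- Along a walk of length `≤ 2r` between two points of one fibre, every vertex projects into
`B_r` of the common image (it is within `r` of one of the two ends). [cite: MartineauSevero2019, §5 proof of Lemma 5.1 ("γ … staying inside π⁻¹(B_r(π(x))) as R ≤ 2r")] -/
theorem qmk_support_mem_graphBall {G : SimpleGraph V} {x y : V} (γ : G.Walk x y) {r : ℕ}
    (hlen : γ.length ≤ 2 * r) (hxy : qmk Γ y = qmk Γ x) {z : V} (hz : z ∈ γ.support) :
    qmk Γ z ∈ graphBall (orbitQuotientGraph G Γ) (qmk Γ x) r := by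
  obtain ⟨q, q', hqq⟩ := exists_split_of_mem_support γ hz
  by_cases hq : q.length ≤ r
  · exact graphBall_mono _ _ hq (qmk_mem_graphBall_of_walk q)
  · have hq' : q'.reverse.length ≤ r := by rw [SimpleGraph.Walk.length_reverse]; omega
    have := graphBall_mono _ _ hq' (qmk_mem_graphBall_of_walk (Γ := Γ) q'.reverse)
    rwa [hxy] at this

/-- **The witness for one sphere vertex.** Given `g` with `g x ≠ x`, `g x ∈ B_{2r}(x)` and a vertex `v`
at distance `r + 1` from `π x`: an `ℋ`-neighbour `w` of `v` at distance `r`, two distinct lifts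
`s(z₁, v₁) ≠ s(z₂, v₂)` of `{w, v}`, and a finite set `F` of witness edges (a walk from `x` to `z₁`, a
walk from `x` to `g x`, and the translate of the first) joining `x` to `z₁` and to `z₂ = g z₁`, all
inside `B_{3r}(x) ∩ π⁻¹(B_r(π x))`, with `|F| ≤ 4r`.
[cite: MartineauSevero2019, §5 Lemma 5.1 (proof) and Step 2K+2 ("at least one lift e' of e that is adjacent to Z(x,r)")] -/
theorem exists_twoLifts_at {G : SimpleGraph V} [G.LocallyFinite] (hG : G.Connected)
    (hact : IsActionByAut G Γ) (hfree : ∀ (g : Γ) (x : V), g • x = x → g = 1) {r : ℕ} {x : V} {g : Γ}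
    (hgx : g • x ≠ x) (hgB : g • x ∈ graphBall G x (2 * r))
    {v : MulAction.orbitRel.Quotient Γ V} (hv : (orbitQuotientGraph G Γ).dist (qmk Γ x) v = r + 1) :
    ∃ (F : Finset (Sym2 V)) (w : MulAction.orbitRel.Quotient Γ V) (z₁ v₁ z₂ v₂ : V),
      (↑F : Set (Sym2 V)) ⊆ G.edgeSet ∧
      (∀ e ∈ F, ∀ z ∈ e, z ∈ graphBall G x (3 * r) ∧
        qmk Γ z ∈ graphBall (orbitQuotientGraph G Γ) (qmk Γ x) r) ∧
      F.card ≤ 4 * r ∧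
      (orbitQuotientGraph G Γ).dist (qmk Γ x) w = r ∧ (orbitQuotientGraph G Γ).Adj w v ∧
      qmk Γ z₁ = w ∧ qmk Γ z₂ = w ∧ qmk Γ v₁ = v ∧ qmk Γ v₂ = v ∧
      G.Adj z₁ v₁ ∧ G.Adj z₂ v₂ ∧ s(z₁, v₁) ≠ s(z₂, v₂) ∧
      (SimpleGraph.fromEdgeSet (↑F : Set (Sym2 V))).Reachable x z₁ ∧
      (SimpleGraph.fromEdgeSet (↑F : Set (Sym2 V))).Reachable x z₂ := by
  classical
  set H := orbitQuotientGraph G Γ with hHdef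
  have hH : H.Connected := quot_connected hG
  -- the neighbour `w` of `v` at distance `r` on a geodesic from `π x`
  obtain ⟨w, hwv, hw⟩ := exists_adj_mem_graphBall_of_dist_eq hH hv
  have hwdist : H.dist (qmk Γ x) w = r := by
    have h1 : H.dist (qmk Γ x) w ≤ r := dist_le_of_mem_graphBall hw
    have h2 := hH.dist_triangle (u := qmk Γ x) (v := w) (w := v)
    rw [SimpleGraph.dist_eq_one_iff_adj.2 hwv, hv] at h2
    omega
  -- lift a geodesic to `w`, then the edge `{w, v}`
  obtain ⟨wH, hwH⟩ := hH.exists_walk_length_eq_dist (qmk Γ x) w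
  obtain ⟨z₁, hz₁, P, hP⟩ := exists_lift_walk hact wH rfl
  obtain ⟨v₁, hz₁v₁, hv₁⟩ := exists_adj_of_quot_adj hact (x := z₁) (u := v) (by rw [hz₁]; exact hwv)
  -- a walk from `x` to `g x`
  obtain ⟨γ, hγ⟩ := hgB
  -- the translated walk
  set gP : G.Walk (g • x) (g • z₁) := P.map (smulIso hact g).toHom with hgP
  have hPlen : P.length = r := by rw [hP, hwH, hwdist]
  have hgPlen : gP.length = r := (SimpleGraph.Walk.length_map _ _).trans hPlen
  -- the witness edges
  set F : Finset (Sym2 V) := P.edges.toFinset ∪ γ.edges.toFinset ∪ gP.edges.toFinset with hFdef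
  refine ⟨F, w, z₁, v₁, g • z₁, g • v₁, ?_, ?_, ?_, hwdist, hwv, hz₁, by rw [qmk_smul, hz₁],
    hv₁, by rw [qmk_smul, hv₁], hz₁v₁, (hact g z₁ v₁).2 hz₁v₁, ?_, ?_, ?_⟩
  · -- witness edges are edges
    intro e he
    simp only [hFdef, Finset.coe_union, List.coe_toFinset, Set.mem_union, Set.mem_setOf_eq] at he
    rcases he with (he | he) | he
    · exact P.edges_subset_edgeSet he
    · exact γ.edges_subset_edgeSet he
    · exact gP.edges_subset_edgeSet he
  · -- endpoints in `B_{3r}(x)` projecting into `B_r(π x)`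
    intro e he z hz
    simp only [hFdef, Finset.mem_union, List.mem_toFinset] at he
    rcases he with (he | he) | he
    · have hzs := SimpleGraph.Walk.mem_support_of_mem_edges he hz
      refine ⟨graphBall_mono _ _ (by omega) (support_subset_graphBall_start P hzs), ?_⟩
      have := qmk_mem_graphBall_of_walk (Γ := Γ) (P.takeUntil z hzs)
      exact graphBall_mono _ _ ((P.length_takeUntil_le_length hzs).trans hPlen.le) this
    · have hzs := SimpleGraph.Walk.mem_support_of_mem_edges he hz
      exact ⟨graphBall_mono _ _ (by omega) ((support_subset_graphBall_start γ hzs) |>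
        graphBall_mono _ _ hγ), qmk_support_mem_graphBall γ hγ (qmk_smul Γ g x) hzs⟩
    · have hzs := SimpleGraph.Walk.mem_support_of_mem_edges he hz
      have hzs' : g⁻¹ • z ∈ P.support := (mem_support_map_smulIso_iff hact g P).1 hzs
      constructor
      · -- `d(x, z) ≤ d(x, g x) + d(g x, z) ≤ 2r + r`
        have h1 : z ∈ graphBall G (g • x) gP.length := support_subset_graphBall_start gP hzs
        rw [hgPlen] at h1
        have := mem_graphBall_trans ⟨γ, hγ⟩ h1
        exact graphBall_mono _ _ (by omega) this
      · have := qmk_mem_graphBall_of_walk (Γ := Γ) (P.takeUntil _ hzs')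
        have h2 := graphBall_mono _ _ ((P.length_takeUntil_le_length hzs').trans hPlen.le) this
        rw [qmk_smul] at h2
        exact h2
  · -- cardinality
    have h1 : P.edges.toFinset.card ≤ r := (List.toFinset_card_le _).trans (by rw [SimpleGraph.Walk.length_edges, hPlen])
    have h2 : γ.edges.toFinset.card ≤ 2 * r := (List.toFinset_card_le _).trans (by rw [SimpleGraph.Walk.length_edges]; exact hγ)
    have h3 : gP.edges.toFinset.card ≤ r := (List.toFinset_card_le _).trans (by
      rw [SimpleGraph.Walk.length_edges, hgPlen])
    calc F.card ≤ (P.edges.toFinset ∪ γ.edges.toFinset).card + gP.edges.toFinset.card := Finset.card_union_le _ _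
      _ ≤ P.edges.toFinset.card + γ.edges.toFinset.card + gP.edges.toFinset.card :=
          Nat.add_le_add_right (Finset.card_union_le _ _) _
      _ ≤ 4 * r := by omega
  · -- the two lifts are distinct (freeness)
    intro heq
    rcases Sym2.eq_iff.1 heq with ⟨h1, -⟩ | ⟨h1, h2⟩
    · have : g = 1 := hfree g z₁ h1.symm
      subst this
      exact hgx (one_smul _ _)
    · -- `z₁ = g v₁`, so `π z₁ = π v₁`, `w = v`: contradicts `dist`
      have : qmk Γ z₁ = qmk Γ v₁ := by rw [h1, qmk_smul]
      rw [hz₁, hv₁] at this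
      rw [this] at hwv
      exact hwv.ne rfl
  · -- `z₁` reachable through `P`
    exact reachable_fromEdgeSet_of_mem_support P (fun e he => by
      simp only [hFdef, Finset.coe_union, List.coe_toFinset, Set.mem_union, Set.mem_setOf_eq]
      exact Or.inl (Or.inl he)) P.end_mem_support
  · -- `g z₁` reachable through `γ` then `g P`
    have hR1 : (SimpleGraph.fromEdgeSet (↑F : Set (Sym2 V))).Reachable x (g • x) :=
      reachable_fromEdgeSet_of_mem_support γ (fun e he => by
        simp only [hFdef, Finset.coe_union, List.coe_toFinset, Set.mem_union, Set.mem_setOf_eq]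
        exact Or.inl (Or.inr he)) γ.end_mem_support
    have hR2 : (SimpleGraph.fromEdgeSet (↑F : Set (Sym2 V))).Reachable (g • x) (g • z₁) :=
      reachable_fromEdgeSet_of_mem_support gP (fun e he => by
        simp only [hFdef, Finset.coe_union, List.coe_toFinset, Set.mem_union, Set.mem_setOf_eq]
        exact Or.inr he) gP.end_mem_support
    exact hR1.trans hR2

/-- **The two-lift witness (Lemma 5.1 for the quotient map of a free action).** With `R ≤ 2r` from
tame fibres: for every `x` there is a finite set `Wt` of witness edges of `𝒢`, all with endpoints in
`B_{3r}(x)` projecting into `B_r(π x)`, of cardinality `≤ 4r (1 + |B_{r+1}(π x)|)`, such that every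
vertex `v` of the sphere `S_{r+1}(π x)` has an `ℋ`-neighbour `w ∈ S_r(π x)` and two distinct lifts
`s(z₁, v₁) ≠ s(z₂, v₂)` of the edge `{w, v}` whose feet `z₁, z₂` are reachable from `x` through
witness edges. In the coupling, at most one of the two lifts is designated, so a fresh one exists.
[cite: MartineauSevero2019, §5 Lemma 5.1 and Step 2K+2] -/
theorem exists_twoLiftWitness {G : SimpleGraph V} [G.LocallyFinite] (hG : G.Connected)
    (hact : IsActionByAut G Γ) (hfree : ∀ (g : Γ) (x : V), g • x = x → g = 1) {R r : ℕ}
    (hRr : R ≤ 2 * r) (hR : ∀ x, ∃ g : Γ, g • x ≠ x ∧ g • x ∈ graphBall G x R) (x : V) :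
    ∃ Wt : Finset (Sym2 V),
      (↑Wt : Set (Sym2 V)) ⊆ G.edgeSet ∧
      (∀ e ∈ Wt, ∀ z ∈ e, z ∈ graphBall G x (3 * r) ∧
        qmk Γ z ∈ graphBall (orbitQuotientGraph G Γ) (qmk Γ x) r) ∧
      Wt.card ≤ 4 * r * (1 + ballVolume (orbitQuotientGraph G Γ) (qmk Γ x) (r + 1)) ∧
      ∀ v, (orbitQuotientGraph G Γ).dist (qmk Γ x) v = r + 1 →
        ∃ (w : MulAction.orbitRel.Quotient Γ V) (z₁ v₁ z₂ v₂ : V),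
          (orbitQuotientGraph G Γ).dist (qmk Γ x) w = r ∧ (orbitQuotientGraph G Γ).Adj w v ∧
          qmk Γ z₁ = w ∧ qmk Γ z₂ = w ∧ qmk Γ v₁ = v ∧ qmk Γ v₂ = v ∧
          G.Adj z₁ v₁ ∧ G.Adj z₂ v₂ ∧ s(z₁, v₁) ≠ s(z₂, v₂) ∧
          (SimpleGraph.fromEdgeSet (↑Wt : Set (Sym2 V))).Reachable x z₁ ∧
          (SimpleGraph.fromEdgeSet (↑Wt : Set (Sym2 V))).Reachable x z₂ := by
  classical
  set H := orbitQuotientGraph G Γ with hHdef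
  haveI : H.LocallyFinite := quotLocallyFinite hact
  obtain ⟨g, hgx, hgB⟩ := hR x
  have hgB' : g • x ∈ graphBall G x (2 * r) := graphBall_mono _ _ hRr hgB
  -- the sphere as a finset
  set S : Finset (MulAction.orbitRel.Quotient Γ V) :=
    (graphBall_finite H (qmk Γ x) (r + 1)).toFinset.filter fun v => H.dist (qmk Γ x) v = r + 1 with hSdef
  have hSmem : ∀ v, v ∈ S ↔ H.dist (qmk Γ x) v = r + 1 := by
    intro v
    rw [hSdef, Finset.mem_filter, Set.Finite.mem_toFinset]
    constructor
    · exact fun h => h.2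
    · intro h
      exact ⟨mem_graphBall_of_dist_le (quot_connected hG) h.le, h⟩
  -- the per-vertex witnesses
  have key : ∀ v : MulAction.orbitRel.Quotient Γ V, ∃ F : Finset (Sym2 V),
      H.dist (qmk Γ x) v = r + 1 →
      ∃ (w : MulAction.orbitRel.Quotient Γ V) (z₁ v₁ z₂ v₂ : V),
        (↑F : Set (Sym2 V)) ⊆ G.edgeSet ∧
        (∀ e ∈ F, ∀ z ∈ e, z ∈ graphBall G x (3 * r) ∧ qmk Γ z ∈ graphBall H (qmk Γ x) r) ∧
        F.card ≤ 4 * r ∧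
        H.dist (qmk Γ x) w = r ∧ H.Adj w v ∧
        qmk Γ z₁ = w ∧ qmk Γ z₂ = w ∧ qmk Γ v₁ = v ∧ qmk Γ v₂ = v ∧
        G.Adj z₁ v₁ ∧ G.Adj z₂ v₂ ∧ s(z₁, v₁) ≠ s(z₂, v₂) ∧
        (SimpleGraph.fromEdgeSet (↑F : Set (Sym2 V))).Reachable x z₁ ∧
        (SimpleGraph.fromEdgeSet (↑F : Set (Sym2 V))).Reachable x z₂ := by
    intro v
    by_cases hv : H.dist (qmk Γ x) v = r + 1
    · obtain ⟨F, w, z₁, v₁, z₂, v₂, h⟩ := exists_twoLifts_at hG hact hfree hgx hgB' hv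
      exact ⟨F, fun _ => ⟨w, z₁, v₁, z₂, v₂, h⟩⟩
    · exact ⟨∅, fun h => absurd h hv⟩
  choose F hF using key
  set Wt : Finset (Sym2 V) := S.biUnion F with hWt
  have hFsub : ∀ v ∈ S, F v ⊆ Wt := fun v hv => Finset.subset_biUnion_of_mem F hv
  refine ⟨Wt, ?_, ?_, ?_, ?_⟩
  · intro e he
    rw [hWt, Finset.coe_biUnion] at he
    obtain ⟨v, hv, he⟩ := Set.mem_iUnion₂.1 he
    exact (hF v ((hSmem v).1 hv)).choose_spec.choose_spec.choose_spec.choose_spec.choose_spec.1 he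
  · intro e he z hz
    rw [hWt, Finset.mem_biUnion] at he
    obtain ⟨v, hv, he⟩ := he
    exact (hF v ((hSmem v).1 hv)).choose_spec.choose_spec.choose_spec.choose_spec.choose_spec.2.1 e he z hz
  · calc Wt.card ≤ ∑ v ∈ S, (F v).card := Finset.card_biUnion_le
      _ ≤ ∑ _v ∈ S, 4 * r := Finset.sum_le_sum fun v hv =>
          (hF v ((hSmem v).1 hv)).choose_spec.choose_spec.choose_spec.choose_spec.choose_spec.2.2.1
      _ = S.card * (4 * r) := by rw [Finset.sum_const, smul_eq_mul]
      _ ≤ ballVolume H (qmk Γ x) (r + 1) * (4 * r) := by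
          refine Nat.mul_le_mul_right _ ?_
          rw [ballVolume, Set.ncard_eq_toFinset_card _ (graphBall_finite H (qmk Γ x) (r + 1)), hSdef]
          exact Finset.card_filter_le _ _
      _ ≤ 4 * r * (1 + ballVolume H (qmk Γ x) (r + 1)) := by nlinarith
  · intro v hv
    obtain ⟨w, z₁, v₁, z₂, v₂, -, -, -, h4, h5, h6, h7, h8, h9, h10, h11, h12, h13, h14⟩ := hF v hv
    have hle : SimpleGraph.fromEdgeSet (↑(F v) : Set (Sym2 V)) ≤ SimpleGraph.fromEdgeSet (↑Wt : Set (Sym2 V)) :=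
      SimpleGraph.fromEdgeSet_mono (Finset.coe_subset.2 (hFsub v ((hSmem v).2 hv)))
    exact ⟨w, z₁, v₁, z₂, v₂, h4, h5, h6, h7, h8, h9, h10, h11, h12, h13.mono hle, h14.mono hle⟩

end TwoLifts

end Literature.Probability.Percolation
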